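import Literature.MathematicalPhysics.QuantumFieldTheory.Balaban1983to89.B6SectCTwoScaleV1

/-!
# `Balaban1983to89.B6SectCTwoScaleV1Lattice` — T. Bałaban, *Propagators and renormalization transformations for lattice gauge
# theories. II*, Commun. Math. Phys. **96** (1984) 223–250 [Balaban1984PropagatorsII], Sect. C pp. 239–246 ON THE V1
# MULTI-LEVEL TORUS CALCULUS, part 2: **`H′_j` of (2.101)–(2.102) CONSTRUCTED** (the solution operator of
# `inf{½‖Δλ′‖² : Q′_jλ′ = μ}`; `Q′_jH′_j = I` and (2.98) `R_jΔH′_j = 0` PROVED), the concrete two-scale data `tsV1`, and the theorems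
# **`isLattice`** (all twelve printed identities of `…B6SectCOperators.TwoScaleData.IsLattice`, incl. (2.103), (2.104), `Q_j` onto and
# (2.96) *"exactly one admissible ω′"*) and **`positive`** (the two positivity facts)

statement-level skeleton of published theorems with citation tags; proofs where landed; nothing here is a claim about the Yang–Mills mass gap

PDF held: `paper:balaban1984-cmp96-propagators-rt-ii` (journal page = PDF page + 222); pp. 239–246 read AS IMAGES on the ×2
renders `run/shared/lean/pub/pub-balaban/b2b-balaban-ref1/pages/1984-cmp96-propagators-rt-II/…-p017…p024-x2.png` (2026-08-21).
CITATION HEADER (lean-in-tree rule).  WHAT IS REPRODUCED: lit-balaban SKELETON rows **B6.Eq2.129 / B6.Eq2.119** (with B6.Eq2.96,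
2.101, 2.103, 2.104): the hypotheses `IsLattice`/`Positive` of `…B6SectCOperators` (under which `…B6Repr2129Positivity.eq2129_of_pos`,
same seat, proves (2.129) p. 246 with every operator constructed) DISCHARGED for the concrete two-scale data of part 1
(`…B6SectCTwoScaleV1`: the nested family `twoScale`, `Q′_j`, `Q_j`, `∂₁`, the admissible `ω`, the axial `B`, `Q″`, `a`).  PHASE-2 seat
p22 (gen 8); owner r03, referee ref-4.  IMPORTS BY NAME, restating nothing: p21's `…B6SectAZeroModesV1.eq_zero_of_curl_constr_eq29`
(the kernel of `Δ_a`) and `eq_zero_of_inGauge_of_laplace_eq_zero` ((2.11)) ARE the two fields of `Positive` for the family `twoScale`;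
p11's `…B5Positivity172Lattice.eq_zero_of_laplace_eq_zero` (Δ injective on `ker Q′_j`) carries the construction of `H′_j`; p38's
`…B5Eq120IterProof.bondAvgIter_grad` is (2.103) and `stairSum_grad` the staircase telescoping behind (2.96); p21's
`…B6SectAOntoV1.liftIter` gives `Q_j` onto; Mathlib's `Submodule.starProjection`, `LinearEquiv.ofInjective`.

PRINT (verbatim).  p. 241: *"λ = Δ⁻²Q′_j*(Q′_jΔ⁻²Q′_j*)⁻¹μ, μ = Q′_jλ. (2.101) … It gives a solution of the variational problem
inf_{λ′:Q′_jλ′=μ} ½‖Δλ′‖². Let us denote the operator in (2.101) by H′_j, so λ = H′_jμ … where the equality Q′_jλ = Q′_jH′_jμ = μ was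
used"*; p. 240: *"‖(I − P_j)∂*A^λ‖² = ‖(I − P_j)(∂*A − Δλ)‖² = ‖(I − P_j)∂*A‖². (2.98) … (I − P_j)Δλ = 0, or Δλ = P_jΔλ. (2.99)"*, (2.96):
*"∫dω′↾_Λδ(Q′₁ω′) Π_{y∈Λ′}δ_{Ax(y)}(Q_jA + ∂₁ω′) = 1"*; p. 241 (2.103)–(2.104) (quoted in part 1).

CONTENTS (0 sorry; standard axioms; `c ≠ 0` the fine lattice factor, `j + 1 ≤ m + K` the standing range, `Λ′` any finite set of
sites of `T^{(j+1)}`, `w > 0`).  §1 **`H′_j`** (`hP`): `Δ` is injective on `N(Q′_j) = ker Q′_j` (`lapN_injective`), hence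
`N(Q′_j) ≅ ΔN(Q′_j)` (`lapNEquiv`); `H′_jμ :=` (block-constant lift of `μ`) `− λ₁`, `λ₁ ∈ N(Q′_j)` with `Δλ₁ =` the orthogonal
projection of `Δ(lift μ)` onto `ΔN(Q′_j)` — the minimiser of `½‖Δλ′‖²` over `Q′_jλ′ = μ`, extended linearly to constants (on the
functions orthogonal to constants, in particular on the admissible `ω`, this is the printed (2.101)); `lapE_hP`, **`Qp_hP`**
(`Q′_jH′_j = I`), **`hP_orth`** ((2.98)–(2.99): `ΔH′_jμ ⊥ ΔN(Q′_j)`).  §2 the data `tsV1 hc Λ′ w : TwoScaleData …` (`Δ = ∂*∂ + ∂∂*` on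
vector fields, `curl`, `∂`, `∂*`, `Δ`, `Q′_j`, admissible `ω`, `H′_j`, `Q_j`, `∂₁` with factor `c/L^j`, axial `B`, `Q″`, `a = diag w`).
§3 **`isLattice`**: `lapV_form` (2.19), `dcE_dE` (`∂∂ = 0`), **`Qv_dE`** ((2.103) `Q_j∂ = ∂₁Q′_j`), **`Qpp_d1`** ((2.104) ⇒ `Q″∂₁ω = 0`),
`Qv_surjective`, `aW_symm`/`aW_pos`, and (2.96): `mem_axial_add_d1_iff` (`B + ∂₁ω` axial on `Λ′` ⟺ `c′(ω(y) − ω(x)) = B(Γ_{y,x})`),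
the explicit `ω′` (`omegaOf`, `omegaOf_mem`, `add_d1_omegaOf_mem`), uniqueness (`admissible_eq_zero_of_flat`), **`axial_existsUnique`**.
§4 **`positive`** (via the dictionary `inGauge_iff_mem` with p21's `InGauge`).  HONEST SCOPE: as part 1 (ℓ² pairings, centred blocks,
fine lattice `T^{(0)}`, unit lattice `T^{(j)}`); `H′_j` on constants is a convention ((2.101) is printed for `μ ⊥ constants`); the
weights do not enter `positive`; NOT summit progress.  The sequel `…B6Eq2129TwoScaleV1` (same seat) applies `eq2129_of_pos`.
Unit `lit-balaban-p22` (gen 8), HOME `run/shared/lean/pub/lit-balaban/`, 2026-08-21.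
-/

noncomputable section

open scoped InnerProductSpace

namespace Literature.MathematicalPhysics.QuantumFieldTheory.Balaban1983to89.B6SectCTwoScaleV1Lattice

open LatticeFieldCalculus B6SectADomainsV1 B6SectAZeroModesV1 B6SectAOntoV1 B6SectAOperatorsV1 B6SectCOperators B6SectCTwoScaleV1
open BalabanImbrieJaffe1984to88.BIJ85AxialPropagator411 (BondSpace PlaqSpace stairSum_add stairSum_smul)
open BalabanImbrieJaffe1984to88.BIJ85GaugeFunction5113 (siteAvgIter_pull)

variable {P : Params}


/-! ## §1  `H′_j` (2.101)–(2.102): the solution operator of `inf{½‖Δλ′‖² : Q′_jλ′ = μ}` -/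

section Hprime

variable {c : ℝ} {j : ℕ}

/-- `N(Q′_j) = ker Q′_j`. [cite: Balaban1984PropagatorsII, (2.95) p.240] -/
abbrev Nj (j : ℕ) : Submodule ℝ (ScalarSpace P) := LinearMap.ker (Qp P j)

variable (c j) in
/-- `Δ` restricted to `N(Q′_j)`. [cite: Balaban1984PropagatorsII, (2.98)–(2.99) p.240] -/
def lapN : ↥(Nj (P := P) j) →ₗ[ℝ] ScalarSpace P := lapE c ∘ₗ (Nj j).subtype

/-- `Δ` is injective on `N(Q′_j)` ([4] p. 25 *"the operator Δ is positive definite on N(Q′_k), thus invertible"*; p11's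
`eq_zero_of_laplace_eq_zero`). [cite: Balaban1984PropagatorsII, (2.99)–(2.100) p.240] -/
theorem lapN_injective (hc : c ≠ 0) (j : ℕ) : Function.Injective (lapN (P := P) c j) := by
  refine (injective_iff_map_eq_zero _).mpr fun n hn => ?_
  have hQ : siteAvgIter j (WithLp.ofLp (n : ScalarSpace P)) = 0 := by
    have h := n.2
    rw [LinearMap.mem_ker] at h
    rw [← ofLp_Qp, h, WithLp.ofLp_zero]
  have hΔ : laplace c (WithLp.ofLp (n : ScalarSpace P)) = 0 := by
    rw [← ofLp_lapE]
    exact (WithLp.ofLp_eq_zero (p := 2)).mpr hn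
  exact Subtype.ext ((WithLp.ofLp_eq_zero (p := 2)).mp (B5Positivity172Lattice.eq_zero_of_laplace_eq_zero hc j hQ hΔ))

/-- `N(Q′_j) ≅ ΔN(Q′_j)` by `Δ`. [cite: Balaban1984PropagatorsII, (2.100) p.240] -/
def lapNEquiv (hc : c ≠ 0) (j : ℕ) : ↥(Nj (P := P) j) ≃ₗ[ℝ] ↥(LinearMap.range (lapN (P := P) c j)) :=
  LinearEquiv.ofInjective _ (lapN_injective hc j)

variable (c j) in
/-- the orthogonal projection onto `ΔN(Q′_j)` (`R_j` of (2.97), valued in the subspace). [cite: Balaban1984PropagatorsII, (2.97) p.240] -/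
def projK : ScalarSpace P →ₗ[ℝ] ↥(LinearMap.range (lapN (P := P) c j)) :=
  LinearMap.codRestrict _ (LinearMap.range (lapN (P := P) c j)).starProjection.toLinearMap
    fun x => Submodule.starProjection_apply_mem _ x

/-- **`H′_j`** (2.101): `H′_jμ` = the block-constant lift of `μ` minus the `λ₁ ∈ N(Q′_j)` whose `Δλ₁` is the orthogonal projection of
`Δ(lift μ)` onto `ΔN(Q′_j)` — i.e. the minimiser of `½‖Δλ′‖²` over `{λ′ : Q′_jλ′ = μ}` (*"It gives a solution of the variational
problem inf_{λ′:Q′_jλ′=μ} ½‖Δλ′‖². Let us denote the operator in (2.101) by H′_j"*), extended linearly to constants.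
[cite: Balaban1984PropagatorsII, (2.101)–(2.102) p.241] -/
def hP (hc : c ≠ 0) (j : ℕ) : USite P j →ₗ[ℝ] ScalarSpace P :=
  pullE P j - (Nj j).subtype ∘ₗ (lapNEquiv (P := P) hc j).symm.toLinearMap ∘ₗ projK c j ∘ₗ lapE c ∘ₗ pullE P j

/-- `ΔH′_jμ = Δ(lift μ) − proj_{ΔN(Q′_j)}Δ(lift μ)`. [cite: Balaban1984PropagatorsII, (2.101) p.241] -/
theorem lapE_hP (hc : c ≠ 0) (j : ℕ) (μ : USite P j) : lapE c (hP hc j μ) = lapE c (pullE P j μ)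
    - (LinearMap.range (lapN (P := P) c j)).starProjection (lapE c (pullE P j μ)) := by
  have key : ∀ y : ↥(LinearMap.range (lapN (P := P) c j)),
      lapE c ((Nj j).subtype ((lapNEquiv hc j).symm y)) = (y : ScalarSpace P) := by
    intro y
    rw [show lapE c ((Nj j).subtype ((lapNEquiv hc j).symm y)) = ((lapNEquiv hc j ((lapNEquiv hc j).symm y) :
        ↥(LinearMap.range (lapN (P := P) c j))) : ScalarSpace P) from rfl, LinearEquiv.apply_symm_apply]
  show lapE c (pullE P j μ - (Nj j).subtype ((lapNEquiv hc j).symm (projK c j (lapE c (pullE P j μ))))) = _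
  rw [map_sub, key, projK, LinearMap.codRestrict_apply]
  rfl

/-- **`Q′_jH′_j = I`** (*"where the equality Q′_jλ = Q′_jH′_jμ = μ was used"*, p. 241; standing range). [cite: Balaban1984PropagatorsII, (2.101) p.241] -/
theorem Qp_hP (hc : c ≠ 0) (hj : j ≤ P.m + P.K) : Qp P j ∘ₗ hP hc j = LinearMap.id := by
  apply LinearMap.ext
  intro μ
  have hn : ∀ n : ↥(Nj (P := P) j), Qp P j ((Nj j).subtype n) = 0 := fun n => n.2
  show Qp P j (pullE P j μ - (Nj j).subtype ((lapNEquiv hc j).symm (projK c j (lapE c (pullE P j μ))))) = μ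
  rw [map_sub, hn, sub_zero, Qp_pullE j hj]

/-- **(2.98)–(2.99) for `H′_j`**: `ΔH′_jμ ⊥ ΔN(Q′_j)`, i.e. `R_jΔH′_jμ = 0` — the variational characterisation of the minimiser.
[cite: Balaban1984PropagatorsII, (2.98)–(2.102) pp.240–241] -/
theorem hP_orth (hc : c ≠ 0) (n : ↥(Nj (P := P) j)) (μ : USite P j) :
    ⟪lapE c (n : ScalarSpace P), lapE c (hP hc j μ)⟫_ℝ = 0 := by
  rw [lapE_hP]
  exact Submodule.inner_right_of_mem_orthogonal (K := LinearMap.range (lapN (P := P) c j))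
    (LinearMap.mem_range_self (lapN c j) n) (Submodule.sub_starProjection_mem_orthogonal _)

end Hprime

/-! ## §2  The data `tsV1` -/

section Data

/-- **The two-scale data of Sect. C on the V1 calculus**: fine lattice `T^{(0)}` with factor `c`, unit lattice `T^{(j)}`,
`Λ′ ⊂ T^{(j+1)}`, weights `w` on `𝔅 = Λ^c ∪ Λ′`; `Δ = ∂*∂ + ∂∂*` on vector fields, `Q′_j`, the admissible `ω`, `H′_j`, `Q_j`,
`∂₁` (factor `c/L^j`), the axial `B`, `Q″`, `a`. [cite: Balaban1984PropagatorsII, (2.95)–(2.104) pp.240–241] -/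
def tsV1 {c : ℝ} (hc : c ≠ 0) {j : ℕ} (Λ' : Finset (Site P (j + 1))) (w : CIdx j Λ' → ℝ) :
    TwoScaleData (BondSpace P) (ScalarSpace P) (USite P j) (PlaqSpace P) (UBond P j) (CSpace j Λ') where
  lapV := dcsE c ∘ₗ dcE c + dE c ∘ₗ dsE c
  curl := dcE c
  grad := dE c
  dv := dsE c
  lap := lapE c
  Qp := Qp P j
  S₁ := admissible P j Λ'
  hP := hP hc j
  Qv := Qv P j
  d1 := d1 P j (c / (P.L : ℝ) ^ j)
  Ax := axial P j Λ'
  Qpp := Qpp P j Λ'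
  a := aW P j Λ' w

end Data

/-! ## §3  `IsLattice`: the printed identities, (2.103), (2.104), `Q_j` onto, and (2.96) -/

section Lattice

variable {c : ℝ} {j : ℕ} (Λ' : Finset (Site P (j + 1)))

/-- `⟨A, (∂*∂ + ∂∂*)A′⟩ = ⟨∂A, ∂A′⟩ + ⟨∂*A, ∂*A′⟩` (2.19). [cite: Balaban1984PropagatorsII, (2.19) p.226] -/
theorem lapV_form (c : ℝ) (v u : BondSpace P) :
    ⟪v, (dcsE c ∘ₗ dcE c + dE c ∘ₗ dsE c : BondSpace P →ₗ[ℝ] BondSpace P) u⟫_ℝ =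
      ⟪dcE c v, dcE c u⟫_ℝ + ⟪dsE c v, dsE c u⟫_ℝ := by
  rw [LinearMap.add_apply, inner_add_right, LinearMap.comp_apply, LinearMap.comp_apply,
    real_inner_comm (dcsE c (dcE c u)) v, inner_dcsE_left, real_inner_comm (dcE c v) (dcE c u),
    real_inner_comm (dE c (dsE c u)) v, inner_dE_left, real_inner_comm (dsE c v) (dsE c u)]

/-- `∂∂λ = 0` (curl of a gradient). [cite: Balaban1984PropagatorsII, (2.19) p.226] -/
theorem dcE_dE (c : ℝ) (f : ScalarSpace P) : dcE c (dE c f) = 0 := by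
  apply PiLp.ext; intro p
  rw [dcE_apply, ofLp_dE, PiLp.zero_apply]
  exact curl_grad c c _ p

/-- **(2.103) `Q_j∂ = ∂₁Q′_j`** ([4] (1.20), p38's `bondAvgIter_grad`; coarse factor `c/L^j`). [cite: Balaban1984PropagatorsII, (2.103) p.241] -/
theorem Qv_dE (hj : j ≤ P.m + P.K) (c : ℝ) (f : ScalarSpace P) :
    Qv P j (dE c f) = d1 P j (c / (P.L : ℝ) ^ j) (Qp P j f) := by
  apply PiLp.ext; intro b
  rw [Qv_apply, ofLp_dE, d1_apply, ofLp_Qp, B5Eq120IterProof.bondAvgIter_grad j hj]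

/-- **(2.104) ⇒ `Q″∂₁ω = 0`** for admissible `ω`: `∂₁ω = 0` on the `Λ^c`-bonds (`ω = 0` there) and `Q₁∂₁ω = ∂^LQ′₁ω = 0` on the
`Λ′`-bonds (`Q′₁ω ≡ 0`). [cite: Balaban1984PropagatorsII, (2.103)–(2.104) p.241] -/
theorem Qpp_d1 (hj : j + 1 ≤ P.m + P.K) (c' : ℝ) (ω : ↥(admissible P j Λ')) :
    Qpp P j Λ' (d1 P j c' (ω : USite P j)) = 0 := by
  apply PiLp.ext; intro i
  rw [PiLp.zero_apply]
  rcases i with ⟨b, hb1, hb2⟩ | ⟨e, he⟩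
  · rw [Qpp_inl, d1_apply]
    change c' • ((ω : USite P j) b.tgt - (ω : USite P j) b.src) = 0
    rw [ω.2.1 _ hb2, ω.2.1 _ hb1, sub_zero, smul_zero]
  · rw [Qpp_inr, ofLp_d1, bondAvg_grad hj]
    change (c' / P.L) • (siteAvg (WithLp.ofLp (ω : USite P j)) e.tgt - siteAvg (WithLp.ofLp (ω : USite P j)) e.src) = 0
    rw [siteAvg_admissible j Λ' hj ω.2, siteAvg_admissible j Λ' hj ω.2, sub_zero, smul_zero]

/-- **`Q_j` is onto** (p21's `k`-fold far-face lift). [cite: Balaban1984PropagatorsII, (2.95)–(2.96) p.240] -/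
theorem Qv_surjective (hj : j ≤ P.m + P.K) : Function.Surjective (Qv P j) := fun B =>
  ⟨WithLp.toLp 2 (liftIter j (WithLp.ofLp B)), PiLp.ext fun b => by
    rw [Qv_apply, WithLp.ofLp_toLp, bondAvgIter_liftIter j hj]⟩

/-- `a` is symmetric. [cite: Balaban1984PropagatorsII, (2.97) p.240] -/
theorem aW_symm (w : CIdx j Λ' → ℝ) (x y : CSpace j Λ') : ⟪aW P j Λ' w x, y⟫_ℝ = ⟪x, aW P j Λ' w y⟫_ℝ := by
  rw [inner_eq_sum, inner_eq_sum]
  exact Finset.sum_congr rfl fun i _ => by rw [aW_apply, aW_apply]; ring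

/-- `a > 0` for positive weights. [cite: Balaban1984PropagatorsII, (2.97) p.240] -/
theorem aW_pos {w : CIdx j Λ' → ℝ} (hw : ∀ i, 0 < w i) (x : CSpace j Λ') (hx : x ≠ 0) : 0 < ⟪x, aW P j Λ' w x⟫_ℝ := by
  rw [inner_eq_sum]
  obtain ⟨i, hi⟩ : ∃ i, x i ≠ 0 :=
    not_forall.mp fun h => hx (PiLp.ext fun i => by rw [PiLp.zero_apply]; exact h i)
  have hle : ∀ k, 0 ≤ x k * aW P j Λ' w x k := fun k => by
    rw [aW_apply, ← mul_assoc, mul_comm (x k), mul_assoc]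
    exact mul_nonneg (hw k).le (mul_self_nonneg _)
  refine (Finset.sum_nonneg fun k _ => hle k).lt_of_ne fun h => hi ?_
  have h0 := (Finset.sum_eq_zero_iff_of_nonneg fun k _ => hle k).mp h.symm i (Finset.mem_univ i)
  rw [aW_apply, ← mul_assoc, mul_comm (x i), mul_assoc] at h0
  exact mul_self_eq_zero.mp ((mul_eq_zero.mp h0).resolve_left (hw i).ne')

/-! ### (2.96): the admissible `ω′` of a configuration `B` -/

/-- every fine site of a block is a `blockSite` (standing range). [folklore] -/
private theorem exists_blockSite_eq (hj : j + 1 ≤ P.m + P.K) (x : Site P j) :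
    ∃ r : Fin P.d → Fin P.L, Site.blockSite (blockOf x) r = x :=
  ⟨Site.blockEquiv hj (blockOf x) ⟨x, rfl⟩, congrArg Subtype.val ((Site.blockEquiv hj (blockOf x)).left_inv ⟨x, rfl⟩)⟩

/-- **`B + ∂₁ω` is axial on `Λ′` iff `c′(ω(y) − ω(x)) = B(Γ_{y,x})`** for `x ∈ B(y)`, `y ∈ Λ′` (staircase telescoping, [4] (1.9)).
[cite: Balaban1984PropagatorsII, (2.96)–(2.97) p.240] -/
theorem mem_axial_add_d1_iff (c' : ℝ) (B : UBond P j) (ω : USite P j) :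
    B + d1 P j c' ω ∈ axial P j Λ' ↔ ∀ Y : Site P (j + 1), Y ∈ Λ' → ∀ r : Fin P.d → Fin P.L,
      c' * (ω (emb Y) - ω (Site.blockSite Y r)) = stairSum (WithLp.ofLp B) (emb Y) (Site.blockSite Y r) := by
  have key : ∀ (Y : Site P (j + 1)) (r : Fin P.d → Fin P.L),
      stairSum (WithLp.ofLp (B + d1 P j c' ω)) (emb Y) (Site.blockSite Y r)
        = stairSum (WithLp.ofLp B) (emb Y) (Site.blockSite Y r) + c' * (ω (Site.blockSite Y r) - ω (emb Y)) := by
    intro Y r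
    rw [WithLp.ofLp_add, stairSum_add, ofLp_d1, B5Eq120IterProof.stairSum_grad]
    rfl
  rw [mem_axial]
  refine forall₃_congr fun Y _ r => ?_
  rw [key]
  constructor
  · intro h
    linear_combination (-1 : ℝ) * h
  · intro h
    linear_combination (-1 : ℝ) * h

/-- the block-axial data `S(x) = B(Γ_{y(x),x})` of `B` (`y(x)` the centre of the block of `x`). [cite: Balaban1984PropagatorsII, (2.96) p.240] -/
def stairData (B : UBond P j) (x : Site P j) : ℝ := stairSum (WithLp.ofLp B) (emb (blockOf x)) x

variable (P) in
/-- the admissible `ω′` of (2.96) for `B`: on the block of `y ∈ Λ′`, `ω′(x) = c′⁻¹((Q′₁S)(y) − S(x))`, `S(x) = B(Γ_{y,x})` (the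
constant `(Q′₁S)(y)` makes `Q′₁ω′(y) = 0`); zero off `B(Λ′)`. [cite: Balaban1984PropagatorsII, (2.96) p.240] -/
def omegaOf (c' : ℝ) (B : UBond P j) : USite P j :=
  WithLp.toLp 2 fun x => if blockOf x ∈ Λ' then c'⁻¹ * (siteAvg (stairData B) (blockOf x) - stairData B x) else 0

/-- components of `ω′`. [cite: Balaban1984PropagatorsII, (2.96) p.240] -/
theorem omegaOf_apply (c' : ℝ) (B : UBond P j) (x : Site P j) : omegaOf P Λ' c' B x =
    if blockOf x ∈ Λ' then c'⁻¹ * (siteAvg (stairData B) (blockOf x) - stairData B x) else 0 := rfl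

/-- `(Q′₁S)(y) = L^{−d} Σ_{x∈B(y)} S(x)`. [cite: Balaban1984PropagatorsII, (2.96) p.240] -/
theorem siteAvg_stairData (B : UBond P j) (Y : Site P (j + 1)) :
    siteAvg (stairData B) Y = (((P.L : ℝ) ^ P.d)⁻¹) * ∑ r : Fin P.d → Fin P.L, stairData B (Site.blockSite Y r) := by
  simp only [siteAvg, smul_eq_mul]

/-- `ω′` is admissible. [cite: Balaban1984PropagatorsII, (2.96) p.240] -/
theorem omegaOf_mem (hj : j + 1 ≤ P.m + P.K) (c' : ℝ) (B : UBond P j) : omegaOf P Λ' c' B ∈ admissible P j Λ' := by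
  refine ⟨fun y hy => ?_, fun Y hY => ?_⟩
  · rw [omegaOf_apply, if_neg hy]
  · have h : ∀ r : Fin P.d → Fin P.L, WithLp.ofLp (omegaOf P Λ' c' B) (Site.blockSite Y r) =
        c'⁻¹ * (siteAvg (stairData B) Y - stairData B (Site.blockSite Y r)) := by
      intro r
      rw [omegaOf_apply, Site.blockOf_blockSite hj, if_pos hY]
    have hL : ((P.L : ℝ) ^ P.d) ≠ 0 := pow_ne_zero _ (Nat.cast_ne_zero.mpr P.L_pos.ne')
    have hA := siteAvg_stairData B Y
    simp only [siteAvg, smul_eq_mul]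
    simp_rw [h]
    rw [← Finset.mul_sum, Finset.sum_sub_distrib, Finset.sum_const, Finset.card_univ, Fintype.card_fun, Fintype.card_fin,
      Fintype.card_fin, nsmul_eq_mul, Nat.cast_pow, hA, mul_inv_cancel_left₀ hL, sub_self, mul_zero, mul_zero]

/-- `B + ∂₁ω′` is axial on `Λ′`. [cite: Balaban1984PropagatorsII, (2.96) p.240] -/
theorem add_d1_omegaOf_mem (hj : j + 1 ≤ P.m + P.K) {c' : ℝ} (hc' : c' ≠ 0) (B : UBond P j) :
    B + d1 P j c' (omegaOf P Λ' c' B) ∈ axial P j Λ' := by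
  rw [mem_axial_add_d1_iff Λ' c']
  intro Y hY r
  rw [omegaOf_apply, omegaOf_apply, Site.blockOf_emb hj, Site.blockOf_blockSite hj, if_pos hY, if_pos hY, ← mul_sub,
    sub_sub_sub_cancel_left, mul_inv_cancel_left₀ hc', stairData, stairData, Site.blockOf_emb hj, stairSum_self,
    Site.blockOf_blockSite hj, sub_zero]

/-- uniqueness: an admissible `δ` with `∂₁δ` axial on `Λ′` vanishes (constant on each block of `Λ′` with zero block average, zero
off `B(Λ′)`). [cite: Balaban1984PropagatorsII, (2.96) p.240] -/
theorem admissible_eq_zero_of_flat (hj : j + 1 ≤ P.m + P.K) {δ : USite P j} (hδ : δ ∈ admissible P j Λ')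
    (hflat : ∀ Y : Site P (j + 1), Y ∈ Λ' → ∀ r : Fin P.d → Fin P.L, δ (emb Y) - δ (Site.blockSite Y r) = 0) : δ = 0 := by
  apply PiLp.ext
  intro x
  rw [PiLp.zero_apply]
  by_cases hx : blockOf x ∈ Λ'
  · obtain ⟨r, hr⟩ := exists_blockSite_eq hj x
    have hconst : ∀ r' : Fin P.d → Fin P.L, WithLp.ofLp δ (Site.blockSite (blockOf x) r') = δ (emb (blockOf x)) :=
      fun r' => (sub_eq_zero.mp (hflat _ hx r')).symm
    have havg := hδ.2 _ hx
    simp only [siteAvg, smul_eq_mul] at havg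
    simp_rw [hconst] at havg
    rw [Finset.sum_const, Finset.card_univ, Fintype.card_fun, Fintype.card_fin, Fintype.card_fin, nsmul_eq_mul,
      Nat.cast_pow, inv_mul_cancel_left₀ (pow_ne_zero _ (Nat.cast_ne_zero.mpr P.L_pos.ne'))] at havg
    rw [← hr, hconst r, havg]
  · exact hδ.1 x hx

/-- **(2.96) *"exactly one admissible ω′ per configuration"***: every `B` on the unit lattice is `B′ − ∂₁ω′` for exactly one
admissible `ω′` with `B′ = B + ∂₁ω′` axial on the blocks of `Λ′` (`∫dω′↾_Λδ(Q′₁ω′)Π_{y∈Λ′}δ_{Ax(y)}(B + ∂₁ω′) = 1`; `c′ ≠ 0`, standing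
range). [cite: Balaban1984PropagatorsII, (2.96) p.240] -/
theorem axial_existsUnique (hj : j + 1 ≤ P.m + P.K) {c' : ℝ} (hc' : c' ≠ 0) (B : UBond P j) :
    ∃! ω : ↥(admissible P j Λ'), B + d1 P j c' (ω : USite P j) ∈ axial P j Λ' := by
  refine ⟨⟨omegaOf P Λ' c' B, omegaOf_mem Λ' hj c' B⟩, add_d1_omegaOf_mem Λ' hj hc' B, fun ω hω => ?_⟩
  apply Subtype.ext
  have h1 := (mem_axial_add_d1_iff Λ' c' B _).mp hω
  have h2 := (mem_axial_add_d1_iff Λ' c' B _).mp (add_d1_omegaOf_mem Λ' hj hc' B)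
  have hδ : (ω : USite P j) - omegaOf P Λ' c' B = 0 :=
    admissible_eq_zero_of_flat Λ' hj ((admissible P j Λ').sub_mem ω.2 (omegaOf_mem Λ' hj c' B)) fun Y hY r => by
      rw [PiLp.sub_apply, PiLp.sub_apply, sub_sub_sub_comm,
        mul_left_cancel₀ hc' ((h1 Y hY r).trans (h2 Y hY r).symm), sub_self]
  exact sub_eq_zero.mp hδ

/-- **`IsLattice` for the concrete two-scale data**: the twelve printed identities of `…B6SectCOperators.TwoScaleData.IsLattice`
hold for `tsV1` (`c ≠ 0`, standing range, positive weights). [cite: Balaban1984PropagatorsII, (2.96)–(2.104) pp.240–241] -/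
theorem isLattice (hc : c ≠ 0) (hj : j + 1 ≤ P.m + P.K) {w : CIdx j Λ' → ℝ} (hw : ∀ i, 0 < w i) :
    (tsV1 hc Λ' w).IsLattice where
  lapV_form := lapV_form c
  grad_adj := inner_dE_left c
  dv_grad _ := rfl
  curl_grad := dcE_dE c
  Qp_hP := Qp_hP hc (Nat.le_of_succ_le hj)
  hP_orth := hP_orth hc
  Qv_grad := Qv_dE (Nat.le_of_succ_le hj) c
  Qpp_d1 := Qpp_d1 Λ' hj _
  Qv_surj := Qv_surjective (Nat.le_of_succ_le hj)
  a_symm := aW_symm Λ' w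
  a_pos := aW_pos Λ' hw
  axial := axial_existsUnique Λ' hj (div_ne_zero hc (pow_ne_zero _ (Nat.cast_ne_zero.mpr P.L_pos.ne')))

end Lattice

/-! ## §4  `Positive`: the kernel of `Δ_a` and (2.11), from p21's V1 theorems -/

section Positive

variable {c : ℝ} {j : ℕ} (Λ' : Finset (Site P (j + 1)))

/-- `N(Q′) = {λ : Q′_jλ admissible}` IS p21's `InGauge` for the two-scale family. [cite: Balaban1984PropagatorsII, (2.104)–(2.105) p.241] -/
theorem inGauge_iff_mem (hj : j + 1 ≤ P.m + P.K) (f : ScalarSpace P) :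
    (twoScale j hj Λ').InGauge (WithLp.ofLp f) ↔ Qp P j f ∈ admissible P j Λ' := by
  rw [twoScale.inGauge_iff, mem_admissible]
  rfl

/-- **`Positive` for the concrete two-scale data**: the kernel of `Δ_a` is trivial (p21's `eq_zero_of_curl_constr_eq29` for the
two-scale family) and `Δ` is injective on `N(Q′)` ((2.11), p21's `eq_zero_of_inGauge_of_laplace_eq_zero`); `c ≠ 0`, standing range
(the weights do not enter). [cite: Balaban1984PropagatorsII, (2.11) p.225 + (2.19)–(2.22) p.226] -/
theorem positive (hc : c ≠ 0) (hj : j + 1 ≤ P.m + P.K) (w : CIdx j Λ' → ℝ) : (tsV1 hc Λ' w).Positive where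
  zeroModes v hcurl horth hQ := by
    change dcE c v = 0 at hcurl
    change Qpp P j Λ' (Qv P j v) = 0 at hQ
    have hcurl' : curl c (WithLp.ofLp v) = 0 := funext fun p => by
      have := congrArg (fun g : PlaqSpace P => g p) hcurl
      simpa using this
    have hQ' : ∀ (i : ℕ) (b : PBond P i), (twoScale j hj Λ').LamBond i b → bondAvgIter i (WithLp.ofLp v) b = 0 := by
      rw [twoScale.constr_zero_iff]
      refine ⟨fun b h1 h2 => ?_, fun e he => ?_⟩
      · have := congrArg (fun g : CSpace j Λ' => g (Sum.inl ⟨b, h1, h2⟩)) hQ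
        simpa using this
      · have := congrArg (fun g : CSpace j Λ' => g (Sum.inr ⟨e, he⟩)) hQ
        simpa [ofLp_Qv] using this
    have h29 : ∀ μ : SiteField P 0 ℝ, (twoScale j hj Λ').InGauge μ →
        ∑ x, laplace c μ x * diverg c (WithLp.ofLp v) x = 0 := by
      intro μ hμ
      have hm : Qp P j (WithLp.toLp 2 μ) ∈ admissible P j Λ' := (inGauge_iff_mem Λ' hj _).mp hμ
      have h := horth ⟨WithLp.toLp 2 μ, hm⟩
      change ⟪lapE c (WithLp.toLp 2 μ), dsE c v⟫_ℝ = 0 at h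
      rw [inner_eq_sum] at h
      simpa [lapE_apply] using h
    exact (WithLp.ofLp_eq_zero (p := 2)).mp (eq_zero_of_curl_constr_eq29 _ hc hcurl' hQ' h29)
  lapInj m hm := by
    change lapE c (m : ScalarSpace P) = 0 at hm
    have hg : (twoScale j hj Λ').InGauge (WithLp.ofLp (m : ScalarSpace P)) := (inGauge_iff_mem Λ' hj _).mpr m.2
    have hΔ : laplace c (WithLp.ofLp (m : ScalarSpace P)) = 0 := by
      rw [← ofLp_lapE]
      exact (WithLp.ofLp_eq_zero (p := 2)).mpr hm
    exact Subtype.ext ((WithLp.ofLp_eq_zero (p := 2)).mp (eq_zero_of_inGauge_of_laplace_eq_zero _ hc hg hΔ))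

end Positive

end Literature.MathematicalPhysics.QuantumFieldTheory.Balaban1983to89.B6SectCTwoScaleV1Lattice

end
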